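import Literature.AnabelianGeometry.SemiGraphs.TemperedMaximalCompactOfNoFixedEdge
import Literature.AnabelianGeometry.SemiGraphs.TemperedAnchoredCompactOfAbelianEdges
import Literature.AnabelianGeometry.SemiGraphs.TemperedPiRayApartment
import Literature.AnabelianGeometry.SemiGraphs.TemperedPiVerticialLevelData
import Literature.AnabelianGeometry.SemiGraphs.OrbitGraphMap
import HarnessLib

/-!
# Verticial ⇒ maximal compact from ONE finite level: the branch-stabiliser criterion
# ([SemiAnbd] Rmk 2.2.1 p. 24, Thm 3.7 (iv) p. 41)

Mochizuki, *Semi-graphs of anabelioids*, Publ. RIMS **42** (2006), Remark 2.2.1 p. 24 ("the image of each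
`Π_v` (respectively, `Π_b`) in `Π_𝒢` is equal to the stabilizer of a compatible system of vertices
(respectively, edges)") and Theorem 3.7 (iv) p. 41 ("the maximal compact subgroups of `π₁^temp(𝒢)` are
precisely the verticial subgroups") [cite: MochizukiSemiAnbd2006, Thm 3.7(iv) p.41].

PROOF-ONLY file (abc-iut cell, layer L3, row «T37iv-VERT⇒MAXCPT@RAYLESS-STAR», generic TOWER half; seat
abc-iut-L3-t6 gen 9; no definition, no named fact).  For a Galois tower `D : GaloisLevelData 𝒢`
(abc-iut-L3-t9) and a compatible point sequence `P` over `w` (abc-iut-L3-t6, `TemperedPiDecomposition.lean`):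

* `PointSeq.exists_conj_forall_gal_of_edgeMap_eq` — abc-iut-L3-t11's one-level branch-stabiliser lemma
  (`TemperedPiBranchStabilizerImage.lean`) in abc-iut-w6-d064's uniform-conjugator form
  (`TemperedAnchoredCompactOfAbelianEdges.lean`: ONE `f ∈ Π_w` per branch `β` of `𝔾̃_n` at `P.vertex n`
  over `b` serves EVERY `g` fixing `β`), read for `g` fixing the EDGE of `β`: `ρ_n g = σ_n^{f·b_*(k)·f⁻¹}`;
* `PointSeq.exists_conj_forall_stabilizes(_proj)_of_forall_edgeMap_eq` — hence if the WHOLE decomposition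
  group `ψ_P(Π_w)` fixes the edge of `β`, then `Π_w = (f Π_b f⁻¹) · Stab(P.pt n)` as a set: every `h ∈ Π_w`
  has `h⁻¹ · f b_*(k) f⁻¹` fixing `P.pt n` (and its image point of the FINITE level `S n`);
* **`isMaximalCompactSubgroup_of_stabilizer_level`** — the criterion at the chart of Prop 3.6: a verticial
  `V = ψ_P(Π_w)` is a MAXIMAL compact subgroup as soon as at ONE level `n` the point stabiliser of
  `(S n)_w` lies in a subgroup `L ≤ Π_w` such that for every branch `b` at `w` and every `f ∈ Π_w` some
  `h ∈ Π_w` avoids `(f Π_b f⁻¹) · L` — then (NOFIX) of `TemperedMaximalCompactOfNoFixedEdge.lean` holds at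
  `P.vertex n` and abc-iut-L3-t6's Kőnig-free `isMaximalCompactSubgroup_of_noFixedEdgeAt` concludes.
Consumer: the rayless star `𝒢⋆(p)` (`MetabelianLeafStarMaximalCompact.lean`).  Nothing here bears on
[IUTchIII] Cor. 3.12; no side taken; typed ≠ proved elsewhere.
-/

noncomputable section

namespace Literature.AnabelianGeometry.SemiGraphs

namespace ProfiniteSemiGraph

open CategoryTheory Topology

universe u

namespace GaloisLevelData

variable {𝒢 : ProfiniteSemiGraph.{u}} {D : GaloisLevelData 𝒢} {h𝒢 : 𝒢.IsCountable}

namespace PointSeq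

variable {w : 𝒢.graph.Vertex} (P : D.PointSeq h𝒢 w)

/-! ### The one-level branch-stabiliser lemma with a UNIFORM conjugator, edge form -/

/-- **Uniform branch-stabiliser lemma, edge form** (Rmk 2.2.1 at one level): for a branch `β` of `𝔾̃_n`
abutting to `P.vertex n` over `b`, ONE `f ∈ Π_w` serves every `g ∈ π₁^temp(𝒢)` fixing the EDGE of `β`:
`ρ_n g = σ_n^{f · b_*(k) · f⁻¹}` for some `k ∈ Π_e` — abc-iut-w6-d064's
`exists_conj_forall_gal_brHom_of_branchMap_eq` (conjugator chosen once per branch, after abc-iut-L3-t11),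
plus «an action over `𝔾` does not switch the branches of a fixed edge».
[cite: MochizukiSemiAnbd2006, Rmk 2.2.1 p.24] -/
theorem exists_conj_forall_gal_of_edgeMap_eq (n : ℕ) (b : 𝒢.graph.Branch)
    (hb : 𝒢.graph.abuts b = some w) (β : (D.tree n).Branch) (hβb : (D.treeProj n).branchMap β = b)
    (hβ : (D.tree n).abuts β = some (P.vertex n)) :
    ∃ f : 𝒢.Gv w, ∀ g : D.temperedPi h𝒢,
      (D.treeAct h𝒢 n g).hom.edgeMap ((D.tree n).edgeOf β) = (D.tree n).edgeOf β →
      ∃ k : 𝒢.Ge (𝒢.graph.edgeOf b), D.proj h𝒢 n g = P.gal n (f * 𝒢.brHom b w hb k * f⁻¹) := by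
  obtain ⟨f, hf⟩ := P.exists_conj_forall_gal_brHom_of_branchMap_eq n b hb β hβb hβ
  exact ⟨f, fun g hfix => hf g (SemiGraph.branchMap_eq_of_over_aut (D.treeProj n) (D.treeAct h𝒢 n g)
    (D.treeAct_over h𝒢 n g) β hfix)⟩

/-! ### The whole decomposition group fixing an edge at its vertex -/

/-- **If the whole decomposition group `ψ_P(Π_w)` fixes the edge of a branch at `P.vertex n` over `b`,
then `Π_w = (f Π_b f⁻¹) · Stab(P.pt n)`** for one `f ∈ Π_w`: every `h ∈ Π_w` has `h⁻¹ · f b_*(k) f⁻¹` in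
the stabiliser of the point `P.pt n ∈ (𝒢_{∞,n})_w` for some `k ∈ Π_e` (the local quotient
`Π_w / Stab(P.pt n)` through which `Π_w` acts at level `n`, `gal_eq_gal_iff`).
[cite: MochizukiSemiAnbd2006, Rmk 2.2.1 p.24] -/
theorem exists_conj_forall_stabilizes_of_forall_edgeMap_eq (n : ℕ) (b : 𝒢.graph.Branch)
    (hb : 𝒢.graph.abuts b = some w) (β : (D.tree n).Branch) (hβb : (D.treeProj n).branchMap β = b)
    (hβ : (D.tree n).abuts β = some (P.vertex n))
    (hfix : ∀ h : 𝒢.Gv w,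
      (D.treeAct h𝒢 n (P.decompHom h)).hom.edgeMap ((D.tree n).edgeOf β) = (D.tree n).edgeOf β) :
    ∃ f : 𝒢.Gv w, ∀ h : 𝒢.Gv w, ∃ k : 𝒢.Ge (𝒢.graph.edgeOf b),
      ((D.cover h𝒢 n).SV w).obj.ρ (h⁻¹ * (f * 𝒢.brHom b w hb k * f⁻¹)) (P.pt n) = P.pt n := by
  obtain ⟨f, hf⟩ := P.exists_conj_forall_gal_of_edgeMap_eq n b hb β hβb hβ
  refine ⟨f, fun h => ?_⟩
  obtain ⟨k, hk⟩ := hf (P.decompHom h) (hfix h)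
  refine ⟨k, ?_⟩
  rw [P.proj_decompHom] at hk
  exact (P.gal_eq_gal_iff n _ _).1 hk

/-- The same read at the FINITE level `S n`: the elements `h⁻¹ · f b_*(k) f⁻¹` fix the image point of
`(S n)_w` under the covering map `𝒢_{∞,S n} → 𝒢_{S n}` (equivariance of its vertex components).
[cite: MochizukiSemiAnbd2006, Prop 3.6 p.38] -/
theorem exists_conj_forall_stabilizes_proj_of_forall_edgeMap_eq (n : ℕ) (b : 𝒢.graph.Branch)
    (hb : 𝒢.graph.abuts b = some w) (β : (D.tree n).Branch) (hβb : (D.treeProj n).branchMap β = b)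
    (hβ : (D.tree n).abuts β = some (P.vertex n))
    (hfix : ∀ h : 𝒢.Gv w,
      (D.treeAct h𝒢 n (P.decompHom h)).hom.edgeMap ((D.tree n).edgeOf β) = (D.tree n).edgeOf β) :
    ∃ f : 𝒢.Gv w, ∀ h : 𝒢.Gv w, ∃ k : 𝒢.Ge (𝒢.graph.edgeOf b),
      ((D.S n).SV w).obj.ρ (h⁻¹ * (f * 𝒢.brHom b w hb k * f⁻¹))
          ((((D.S n).univCoverOverProj (Sum.inl (D.W n)) h𝒢).fV w).hom.hom (P.pt n)) =
        (((D.S n).univCoverOverProj (Sum.inl (D.W n)) h𝒢).fV w).hom.hom (P.pt n) := by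
  obtain ⟨f, hf⟩ := P.exists_conj_forall_stabilizes_of_forall_edgeMap_eq n b hb β hβb hβ hfix
  refine ⟨f, fun h => ?_⟩
  obtain ⟨k, hk⟩ := hf h
  refine ⟨k, ?_⟩
  have h1 := CovHom.fV_ρ ((D.S n).univCoverOverProj (Sum.inl (D.W n)) h𝒢) w
    (h⁻¹ * (f * 𝒢.brHom b w hb k * f⁻¹)) (P.pt n)
  exact h1.symm.trans (congrArg _ hk)

end PointSeq

end GaloisLevelData

/-! ### The criterion at the chart of Prop 3.6 -/

/-- **Verticial ⇒ MAXIMAL compact from ONE finite level** (the branch-stabiliser criterion at the chart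
`𝒢.temperedPiChart h36` of Prop 3.6, any countable `𝒢` satisfying the hypotheses of Thm 3.7): the verticial
subgroup `V = ψ_P(Π_w)` of a point sequence `P` over `w` is a maximal compact subgroup of `π₁^temp(𝒢)` as
soon as at ONE level `n` the stabiliser in `Π_w` of the image point of `(S n)_w` lies in a subgroup
`L ≤ Π_w` such that for every branch `b` at `w` and every `f ∈ Π_w` some `h ∈ Π_w` avoids the set
`(f Π_b f⁻¹) · L` — for then no edge of `𝔾̃_n` at `P.vertex n` is fixed by all of `V` ((NOFIX) of
`TemperedMaximalCompactOfNoFixedEdge.lean`) and the Kőnig-free `isMaximalCompactSubgroup_of_noFixedEdgeAt`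
concludes, over the level data `verticialLevelData_temperedPiChart` of abc-iut-L3-t8.
[cite: MochizukiSemiAnbd2006, Thm 3.7(iv) p.41] -/
theorem isMaximalCompactSubgroup_of_stabilizer_level {𝒢 : ProfiniteSemiGraph.{u}}
    (h37 : 𝒢.Thm37Hypotheses) {w : 𝒢.graph.Vertex}
    (P : (𝒢.galoisLevelData h37.toProp36Hypotheses).PointSeq h37.toProp36Hypotheses.isCountable w)
    {V : Subgroup (𝒢.temperedPiChart h37.toProp36Hypotheses).G}
    (hV : V ∈ verticialSubgroups (𝒢.temperedPiChart h37.toProp36Hypotheses) w)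
    (hPV : P.decompHom.range = V) (n : ℕ) (L : Subgroup (𝒢.Gv w))
    (hL : ∀ u : 𝒢.Gv w,
      (((𝒢.galoisLevelData h37.toProp36Hypotheses).S n).SV w).obj.ρ u
          (((((𝒢.galoisLevelData h37.toProp36Hypotheses).S n).univCoverOverProj
            (Sum.inl ((𝒢.galoisLevelData h37.toProp36Hypotheses).W n))
            h37.toProp36Hypotheses.isCountable).fV w).hom.hom (P.pt n)) =
        ((((𝒢.galoisLevelData h37.toProp36Hypotheses).S n).univCoverOverProj
            (Sum.inl ((𝒢.galoisLevelData h37.toProp36Hypotheses).W n))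
            h37.toProp36Hypotheses.isCountable).fV w).hom.hom (P.pt n) → u ∈ L)
    (hwit : ∀ (b : 𝒢.graph.Branch) (hb : 𝒢.graph.abuts b = some w) (f : 𝒢.Gv w),
      ∃ h : 𝒢.Gv w, ∀ k : 𝒢.Ge (𝒢.graph.edgeOf b), h⁻¹ * (f * 𝒢.brHom b w hb k * f⁻¹) ∉ L) :
    IsMaximalCompactSubgroup V := by
  let D₀ : VerticialLevelData.{0} 𝒢 (𝒢.temperedPiChart h37.toProp36Hypotheses) :=
    verticialLevelData_temperedPiChart (h36 := h37.toProp36Hypotheses)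
  refine D₀.isMaximalCompactSubgroup_of_noFixedEdgeAt h37 hV (x := P.vertex)
    (fun i j h => P.treeTrans_vertex h) ?_ ⟨n, ?_⟩
  · rintro g hg j
    rw [← hPV] at hg
    obtain ⟨h, rfl⟩ := hg
    exact P.treeAct_decompHom_vertexMap j h
  · intro β hβ
    by_contra hall
    push Not at hall
    have hbw : 𝒢.graph.abuts (((𝒢.galoisLevelData h37.toProp36Hypotheses).treeProj n).branchMap β) =
        some w := by
      have h := ((𝒢.galoisLevelData h37.toProp36Hypotheses).treeProj n).abuts_branchMap β (P.vertex n) hβ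
      rwa [P.treeProj_vertexMap_vertex] at h
    obtain ⟨f, hf⟩ := P.exists_conj_forall_stabilizes_proj_of_forall_edgeMap_eq n _ hbw β rfl hβ
      (fun h => hall (P.decompHom h) (hPV ▸ ⟨h, rfl⟩))
    obtain ⟨h, hh⟩ := hwit _ hbw f
    obtain ⟨k, hk⟩ := hf h
    exact hh k (hL _ hk)

/-- **Criterion, subgroup form**: the same for an ARBITRARY verticial subgroup `V` at `w` of the chart of
Prop 3.6, the level witness being required for every point sequence `P` with `ψ_P(Π_w) = V` (every
verticial homomorphism is such a `ψ_P`, abc-iut-L3-t8's `exists_pointSeq_of_isVerticialHom`).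
[cite: MochizukiSemiAnbd2006, Thm 3.7(iv) p.41] -/
theorem isMaximalCompactSubgroup_of_forall_pointSeq_stabilizer_level {𝒢 : ProfiniteSemiGraph.{u}}
    (h37 : 𝒢.Thm37Hypotheses) {w : 𝒢.graph.Vertex}
    {V : Subgroup (𝒢.temperedPiChart h37.toProp36Hypotheses).G}
    (hV : V ∈ verticialSubgroups (𝒢.temperedPiChart h37.toProp36Hypotheses) w)
    (hcrit : ∀ P : (𝒢.galoisLevelData h37.toProp36Hypotheses).PointSeq h37.toProp36Hypotheses.isCountable w,
      P.decompHom.range = V → ∃ (n : ℕ) (L : Subgroup (𝒢.Gv w)),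
        (∀ u : 𝒢.Gv w,
          (((𝒢.galoisLevelData h37.toProp36Hypotheses).S n).SV w).obj.ρ u
              (((((𝒢.galoisLevelData h37.toProp36Hypotheses).S n).univCoverOverProj
                (Sum.inl ((𝒢.galoisLevelData h37.toProp36Hypotheses).W n))
                h37.toProp36Hypotheses.isCountable).fV w).hom.hom (P.pt n)) =
            ((((𝒢.galoisLevelData h37.toProp36Hypotheses).S n).univCoverOverProj
                (Sum.inl ((𝒢.galoisLevelData h37.toProp36Hypotheses).W n))
                h37.toProp36Hypotheses.isCountable).fV w).hom.hom (P.pt n) → u ∈ L) ∧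
        ∀ (b : 𝒢.graph.Branch) (hb : 𝒢.graph.abuts b = some w) (f : 𝒢.Gv w),
          ∃ h : 𝒢.Gv w, ∀ k : 𝒢.Ge (𝒢.graph.edgeOf b), h⁻¹ * (f * 𝒢.brHom b w hb k * f⁻¹) ∉ L) :
    IsMaximalCompactSubgroup V := by
  obtain ⟨χ, hχ, rfl⟩ := hV
  obtain ⟨P, hP⟩ := exists_pointSeq_of_isVerticialHom (h36 := h37.toProp36Hypotheses) (v := w) (ψ := χ) hχ
  have hPV : P.decompHom.range = χ.toMonoidHom.range := by rw [hP]; rfl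
  obtain ⟨n, L, hL, hwit⟩ := hcrit P hPV
  exact isMaximalCompactSubgroup_of_stabilizer_level h37 P ⟨χ, hχ, rfl⟩ hPV n L hL hwit

end ProfiniteSemiGraph

end Literature.AnabelianGeometry.SemiGraphs

end
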